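import Summits.CriticalPhenomena.PercolationContinuityZ3.Theorems.PercNearOneGluingAdditiveGluingBlockGrowth
import Summits.CriticalPhenomena.PercolationContinuityZ3.Theorems.PercNearOneGluingAdditiveGluingSigmaRecursion
import Summits.CriticalPhenomena.PercolationContinuityZ3.Theorems.PercNearOneGluingAdditiveGluingLemma5AnyRelay
import Literature.Probability.Percolation.BlockExplorationBasic
import Summits.CriticalPhenomena.PercolationContinuityZ3.Theorems.PercNearOneGluingAdditiveGluingWholeBlockReach
import Summits.CriticalPhenomena.PercolationContinuityZ3.Theorems.PercNearOneGluingAdditiveGluingWholeBlockDesignated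
import Summits.CriticalPhenomena.PercolationContinuityZ3.Theorems.PercNearOneGluingAdditiveGluingWholeBlockPockets
import Summits.CriticalPhenomena.PercolationContinuityZ3.Theorems.PercNearOneGluingAdditiveGluingIsolatedBlock
import Summits.CriticalPhenomena.PercolationContinuityZ3.Theorems.PercNearOneGluingAdditiveGluingBystanderKernel
import HarnessLib

/-! # Crux `PercNearOneGluing.AdditiveGluing` (stmt-CriticalPhenomena-4576), line `peel`, skeleton v7 — the WHOLE-BLOCK KERNEL

Lead c5; lands `--supports stmt-CriticalPhenomena-4576`.  No definitions, no named facts.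

`wholeBlockKernel_of`: from the three whole-block σ-identities (reach / designated / pockets, hub set = the block `S`,
registered stubs `stub_wholeBlock{Reach,Designated,Pockets}_c5`), the isolated-block lemma (`stub_isolatedBlock_c5`) and block
goodness in every strictly smaller weighting (`HBLK`), a non-negative WHOLE-BLOCK CERTIFICATE
`0 ≤ Σ_N μ_{u/S}(L_N)·c_N` (`c_N = τ_{q_N}(d↔b) − τ_{q_N}(a₀↔b)` on layers avoiding `A`, `μ_{q_N}(N↔b) − τ_{q_N}(a₀↔b)` on layers
meeting `A`; `d` a minimiser of the star-killed two-point function) makes the block `S` `a₀`-good (worst selection).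
Proof: glue the block (`blockGrowth_glue_real_*`), expand the three block quantities over the layers, and compare termwise:
relay layers lose only the pockets (`≥ 0`); on a relay-free layer of positive mass the layer block `N` is `d`-good in the
star-killed weighting (`HBLK`: a vertex of `S` joined to `N` has positive degree in `u` and degree `0` there) and gluing `N`
turns that into `τ_{q_N}(d↔b) ≤ reach + pockets`; the empty layer is the identity `pockets(∅) = min_A τ`.
[cite: KozmaNitzan2024, §3.2 Thms 4–5 pp. 12–14]
-/

namespace Summit.CriticalPhenomena.PercolationContinuityZ3.Theorems

open MeasureTheory Set
open Literature.Probability.LatticeModels (prodBernoulli)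
open Literature.Probability.Percolation (BondConfig openConn openConnIn openGraph openCluster)
open scoped BigOperators

noncomputable section
open Classical

section WholeBlockKernel

open Literature.Probability.LatticeModels Literature.Probability.Percolation

variable {n : ℕ}

/-- The empty-layer weighting: gluing the empty set changes nothing, so `q_∅` is the star-killed weighting. -/
theorem wbk_q_empty (u : Sym2 (Fin n) → unitInterval) (S : Finset (Fin n)) :
    (fun e : Sym2 (Fin n) => if (∀ y ∈ e, y ∈ (∅ : Finset (Fin n))) ∧ ¬ e.IsDiag then 1 else
        if (∃ y ∈ e, y ∈ S) then 0 else u e)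
      = (fun e : Sym2 (Fin n) => if (∃ y ∈ e, y ∈ S) then (0 : unitInterval) else u e) := by
  funext e
  have hnot : ¬ ((∀ y ∈ e, y ∈ (∅ : Finset (Fin n))) ∧ ¬ e.IsDiag) := by
    rintro ⟨hall, -⟩
    exact (Finset.notMem_empty _) (hall e.out.1 (Sym2.out_fst_mem e))
  simp only [hnot, if_false]

/-- **The whole-block kernel** from its ingredients: the three whole-block σ-identities, the isolated-block lemma, `HBLK`,
and a non-negative whole-block certificate give block goodness of `S` at `a₀` (worst selection). -/
theorem wholeBlockKernel_of
    (hR : ∀ (n : ℕ) (u : Sym2 (Fin n) → unitInterval) (S : Finset (Fin n)) (b : Fin n), b ∉ S →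
        (prodBernoulli (fun e : Sym2 (Fin n) => if (∀ y ∈ e, y ∈ S) ∧ ¬ e.IsDiag then 1 else u e)).real (⋃ v ∈ S, openConn v b)
          = ∑ N : Finset (Fin n), (prodBernoulli (fun e : Sym2 (Fin n) => if (∀ y ∈ e, y ∈ S) ∧ ¬ e.IsDiag then 1 else u e)).real {ω : BondConfig (Fin n) | ∀ y : Fin n, y ∈ N ↔ (y ∉ S ∧ ∃ o ∈ S, s(o, y) ∈ ω)}
              * (prodBernoulli (fun e : Sym2 (Fin n) => if (∀ y ∈ e, y ∈ N) ∧ ¬ e.IsDiag then 1 else if (∃ y ∈ e, y ∈ S) then 0 else u e)).real (⋃ v ∈ N, openConn v b))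
    (hD : ∀ (n : ℕ) (u : Sym2 (Fin n) → unitInterval) (S : Finset (Fin n)) (d b : Fin n), d ∉ S → b ∉ S →
        (prodBernoulli (fun e : Sym2 (Fin n) => if (∀ y ∈ e, y ∈ S) ∧ ¬ e.IsDiag then 1 else u e)).real (openConn d b)
          = ∑ N : Finset (Fin n), (prodBernoulli (fun e : Sym2 (Fin n) => if (∀ y ∈ e, y ∈ S) ∧ ¬ e.IsDiag then 1 else u e)).real {ω : BondConfig (Fin n) | ∀ y : Fin n, y ∈ N ↔ (y ∉ S ∧ ∃ o ∈ S, s(o, y) ∈ ω)}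
              * (prodBernoulli (fun e : Sym2 (Fin n) => if (∀ y ∈ e, y ∈ N) ∧ ¬ e.IsDiag then 1 else if (∃ y ∈ e, y ∈ S) then 0 else u e)).real (openConn d b))
    (hP : ∀ (n : ℕ) (u : Sym2 (Fin n) → unitInterval) (A S : Finset (Fin n)) (b : Fin n) (hb : b ∈ A), Disjoint S A →
        (∑ W ∈ (Finset.univ : Finset (Finset (Fin n))).filter (fun W => Disjoint W A),
                (prodBernoulli (fun e : Sym2 (Fin n) => if (∀ y ∈ e, y ∈ S) ∧ ¬ e.IsDiag then 1 else u e)).real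
                    {ω : BondConfig (Fin n) | ∀ z : Fin n, (z ∈ W ↔ ω ∈ ⋃ v ∈ S, openConn v z)}
                  * A.inf' ⟨b, hb⟩ (fun a => (prodBernoulli (fun e : Sym2 (Fin n) => if (∀ y ∈ e, y ∈ S) ∧ ¬ e.IsDiag then 1 else u e)).real (openConnIn ((W : Set (Fin n))ᶜ) a b)))
          = ∑ N : Finset (Fin n), (prodBernoulli (fun e : Sym2 (Fin n) => if (∀ y ∈ e, y ∈ S) ∧ ¬ e.IsDiag then 1 else u e)).real {ω : BondConfig (Fin n) | ∀ y : Fin n, y ∈ N ↔ (y ∉ S ∧ ∃ o ∈ S, s(o, y) ∈ ω)}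
              * (∑ W ∈ (Finset.univ : Finset (Finset (Fin n))).filter (fun W => Disjoint W A),
                (prodBernoulli (fun e : Sym2 (Fin n) => if (∀ y ∈ e, y ∈ N) ∧ ¬ e.IsDiag then 1 else if (∃ y ∈ e, y ∈ S) then 0 else u e)).real
                    {ω : BondConfig (Fin n) | ∀ z : Fin n, (z ∈ W ↔ ω ∈ ⋃ v ∈ N, openConn v z)}
                  * A.inf' ⟨b, hb⟩ (fun a => (prodBernoulli (fun e : Sym2 (Fin n) => if (∀ y ∈ e, y ∈ N) ∧ ¬ e.IsDiag then 1 else if (∃ y ∈ e, y ∈ S) then 0 else u e)).real (openConnIn ((W : Set (Fin n))ᶜ) a b))))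
    (hIso : ∀ (n : ℕ) (u : Sym2 (Fin n) → unitInterval) (A S : Finset (Fin n)) (b a₀ : Fin n) (hb : b ∈ A),
        Disjoint S A → a₀ ∈ A →
        (∀ a ∈ A, (prodBernoulli u).real (openConn a₀ b) ≤ (prodBernoulli u).real (openConn a b)) →
        (∀ v ∈ S, ∀ y : Fin n, (u s(y, v) : ℝ) = 0) →
        (prodBernoulli u).real (openConn a₀ b)
            + (prodBernoulli u).real
                ((openConn a₀ b)ᶜ ∩ (⋃ v ∈ S, openConn a₀ v) ∩ (⋃ v ∈ S, openConn v b))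
          ≤ (prodBernoulli u).real (⋃ v ∈ S, openConn v b)
            + (∑ W ∈ (Finset.univ : Finset (Finset (Fin n))).filter (fun W => Disjoint W A),
                (prodBernoulli u).real
                    {ω : BondConfig (Fin n) | ∀ z : Fin n, (z ∈ W ↔ ω ∈ ⋃ v ∈ S, openConn v z)}
                  * A.inf' ⟨b, hb⟩ (fun a => (prodBernoulli u).real (openConnIn ((W : Set (Fin n))ᶜ) a b)))) :
    ∀ (n : ℕ) (u : Sym2 (Fin n) → unitInterval) (A S : Finset (Fin n)) (b a₀ d : Fin n) (hb : b ∈ A),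
      Disjoint S A → a₀ ∈ A → d ∈ A →
      (∀ a ∈ A, (prodBernoulli u).real (openConn a₀ b) ≤ (prodBernoulli u).real (openConn a b)) →
      (∀ a ∈ A, (prodBernoulli (fun e : Sym2 (Fin n) => if (∃ y ∈ e, y ∈ S) then (0 : unitInterval) else u e)).real (openConn d b) ≤ (prodBernoulli (fun e : Sym2 (Fin n) => if (∃ y ∈ e, y ∈ S) then (0 : unitInterval) else u e)).real (openConn a b)) →
      (∀ w' : Sym2 (Fin n) → unitInterval,
        (Finset.univ.filter (fun v : Fin n => ∃ y : Fin n, 0 < (w' s(y, v) : ℝ))).card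
          < (Finset.univ.filter (fun v : Fin n => ∃ y : Fin n, 0 < (u s(y, v) : ℝ))).card →
        ∀ (A' S' : Finset (Fin n)) (b' d' : Fin n) (hb' : b' ∈ A'), Disjoint S' A' → d' ∈ A' →
        (∀ a ∈ A', (prodBernoulli w').real (openConn d' b') ≤ (prodBernoulli w').real (openConn a b')) →
        (prodBernoulli w').real (openConn d' b')
          + (prodBernoulli w').real
              ((openConn d' b')ᶜ ∩ (⋃ v ∈ S', openConn d' v) ∩ (⋃ v ∈ S', openConn v b'))
        ≤ (prodBernoulli w').real (⋃ v ∈ S', openConn v b')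
          + (∑ W ∈ (Finset.univ : Finset (Finset (Fin n))).filter (fun W => Disjoint W A'),
              (prodBernoulli w').real
                  {ω : BondConfig (Fin n) | ∀ z : Fin n, (z ∈ W ↔ ω ∈ ⋃ v ∈ S', openConn v z)}
                * A'.inf' ⟨b', hb'⟩ (fun a => (prodBernoulli w').real (openConnIn ((W : Set (Fin n))ᶜ) a b')))) →
      0 ≤ ∑ N : Finset (Fin n), (prodBernoulli (fun e : Sym2 (Fin n) => if (∀ y ∈ e, y ∈ S) ∧ ¬ e.IsDiag then 1 else u e)).real {ω : BondConfig (Fin n) | ∀ y : Fin n, y ∈ N ↔ (y ∉ S ∧ ∃ o ∈ S, s(o, y) ∈ ω)}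
          * (if Disjoint N A then
              (prodBernoulli (fun e : Sym2 (Fin n) => if (∀ y ∈ e, y ∈ N) ∧ ¬ e.IsDiag then 1 else if (∃ y ∈ e, y ∈ S) then 0 else u e)).real (openConn d b) - (prodBernoulli (fun e : Sym2 (Fin n) => if (∀ y ∈ e, y ∈ N) ∧ ¬ e.IsDiag then 1 else if (∃ y ∈ e, y ∈ S) then 0 else u e)).real (openConn a₀ b)
            else
              (prodBernoulli (fun e : Sym2 (Fin n) => if (∀ y ∈ e, y ∈ N) ∧ ¬ e.IsDiag then 1 else if (∃ y ∈ e, y ∈ S) then 0 else u e)).real (⋃ v ∈ N, openConn v b) - (prodBernoulli (fun e : Sym2 (Fin n) => if (∀ y ∈ e, y ∈ N) ∧ ¬ e.IsDiag then 1 else if (∃ y ∈ e, y ∈ S) then 0 else u e)).real (openConn a₀ b)) →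
      (prodBernoulli u).real (openConn a₀ b)
          + (prodBernoulli u).real
              ((openConn a₀ b)ᶜ ∩ (⋃ v ∈ S, openConn a₀ v) ∩ (⋃ v ∈ S, openConn v b))
        ≤ (prodBernoulli u).real (⋃ v ∈ S, openConn v b)
          + (∑ W ∈ (Finset.univ : Finset (Finset (Fin n))).filter (fun W => Disjoint W A),
              (prodBernoulli u).real
                  {ω : BondConfig (Fin n) | ∀ z : Fin n, (z ∈ W ↔ ω ∈ ⋃ v ∈ S, openConn v z)}
                * A.inf' ⟨b, hb⟩ (fun a => (prodBernoulli u).real (openConnIn ((W : Set (Fin n))ᶜ) a b))) := by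
  intro n u A S b a₀ d hb hSA ha₀ hdA hmin hdmin hblk hsum
  -- the degenerate case: every vertex of the block is isolated
  by_cases hiso : ∀ v ∈ S, ∀ y : Fin n, (u s(y, v) : ℝ) = 0
  · exact hIso n u A S b a₀ hb hSA ha₀ hmin hiso
  have hbS : b ∉ S := fun h => Finset.disjoint_left.1 hSA h hb
  have ha₀S : a₀ ∉ S := fun h => Finset.disjoint_left.1 hSA h ha₀
  -- (1) glue the block: all three block quantities of `S` are the same under `u` and `u/S`
  rw [← blockGrowth_glue_real_openConn u S a₀ b, ← blockGrowth_glue_real_iUnion u S b,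
    ← bk_pockets_glue u A S b hb]
  -- (2) expand over the layers
  rw [hD n u S a₀ b ha₀S hbS, hR n u S b hbS, hP n u A S b hb hSA]
  -- (3) termwise comparison with the certificate
  have hterm : ∀ N : Finset (Fin n),
      (prodBernoulli (fun e : Sym2 (Fin n) => if (∀ y ∈ e, y ∈ S) ∧ ¬ e.IsDiag then 1 else u e)).real {ω : BondConfig (Fin n) | ∀ y : Fin n, y ∈ N ↔ (y ∉ S ∧ ∃ o ∈ S, s(o, y) ∈ ω)}
          * (if Disjoint N A then
              (prodBernoulli (fun e : Sym2 (Fin n) => if (∀ y ∈ e, y ∈ N) ∧ ¬ e.IsDiag then 1 else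
                if (∃ y ∈ e, y ∈ S) then 0 else u e)).real (openConn d b)
              - (prodBernoulli (fun e : Sym2 (Fin n) => if (∀ y ∈ e, y ∈ N) ∧ ¬ e.IsDiag then 1 else
                if (∃ y ∈ e, y ∈ S) then 0 else u e)).real (openConn a₀ b)
            else
              (prodBernoulli (fun e : Sym2 (Fin n) => if (∀ y ∈ e, y ∈ N) ∧ ¬ e.IsDiag then 1 else
                if (∃ y ∈ e, y ∈ S) then 0 else u e)).real (⋃ v ∈ N, openConn v b)
              - (prodBernoulli (fun e : Sym2 (Fin n) => if (∀ y ∈ e, y ∈ N) ∧ ¬ e.IsDiag then 1 else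
                if (∃ y ∈ e, y ∈ S) then 0 else u e)).real (openConn a₀ b))
        ≤ (prodBernoulli (fun e : Sym2 (Fin n) => if (∀ y ∈ e, y ∈ S) ∧ ¬ e.IsDiag then 1 else u e)).real {ω : BondConfig (Fin n) | ∀ y : Fin n, y ∈ N ↔ (y ∉ S ∧ ∃ o ∈ S, s(o, y) ∈ ω)}
            * (prodBernoulli (fun e : Sym2 (Fin n) => if (∀ y ∈ e, y ∈ N) ∧ ¬ e.IsDiag then 1 else
                if (∃ y ∈ e, y ∈ S) then 0 else u e)).real (⋃ v ∈ N, openConn v b)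
          + (prodBernoulli (fun e : Sym2 (Fin n) => if (∀ y ∈ e, y ∈ S) ∧ ¬ e.IsDiag then 1 else u e)).real {ω : BondConfig (Fin n) | ∀ y : Fin n, y ∈ N ↔ (y ∉ S ∧ ∃ o ∈ S, s(o, y) ∈ ω)}
            * (∑ W ∈ (Finset.univ : Finset (Finset (Fin n))).filter (fun W => Disjoint W A),
                (prodBernoulli (fun e : Sym2 (Fin n) => if (∀ y ∈ e, y ∈ N) ∧ ¬ e.IsDiag then 1 else
                  if (∃ y ∈ e, y ∈ S) then 0 else u e)).real
                    {ω : BondConfig (Fin n) | ∀ z : Fin n, (z ∈ W ↔ ω ∈ ⋃ v ∈ N, openConn v z)}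
                  * A.inf' ⟨b, hb⟩ (fun a => (prodBernoulli (fun e : Sym2 (Fin n) => if (∀ y ∈ e, y ∈ N) ∧ ¬ e.IsDiag then 1 else
                      if (∃ y ∈ e, y ∈ S) then 0 else u e)).real (openConnIn ((W : Set (Fin n))ᶜ) a b)))
          - (prodBernoulli (fun e : Sym2 (Fin n) => if (∀ y ∈ e, y ∈ S) ∧ ¬ e.IsDiag then 1 else u e)).real {ω : BondConfig (Fin n) | ∀ y : Fin n, y ∈ N ↔ (y ∉ S ∧ ∃ o ∈ S, s(o, y) ∈ ω)}
            * (prodBernoulli (fun e : Sym2 (Fin n) => if (∀ y ∈ e, y ∈ N) ∧ ¬ e.IsDiag then 1 else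
                if (∃ y ∈ e, y ∈ S) then 0 else u e)).real (openConn a₀ b) := by
    intro N
    set qN : Sym2 (Fin n) → unitInterval := fun e => if (∀ y ∈ e, y ∈ N) ∧ ¬ e.IsDiag then 1 else
      if (∃ y ∈ e, y ∈ S) then 0 else u e with hqN
    set m : ℝ := (prodBernoulli (fun e : Sym2 (Fin n) => if (∀ y ∈ e, y ∈ S) ∧ ¬ e.IsDiag then 1 else u e)).real
      {ω : BondConfig (Fin n) | ∀ y : Fin n, y ∈ N ↔ (y ∉ S ∧ ∃ o ∈ S, s(o, y) ∈ ω)} with hm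
    have hm0 : 0 ≤ m := measureReal_nonneg
    have hpk0 : 0 ≤ ∑ W ∈ (Finset.univ : Finset (Finset (Fin n))).filter (fun W => Disjoint W A),
        (prodBernoulli qN).real {ω : BondConfig (Fin n) | ∀ z : Fin n, (z ∈ W ↔ ω ∈ ⋃ v ∈ N, openConn v z)}
          * A.inf' ⟨b, hb⟩ (fun a => (prodBernoulli qN).real (openConnIn ((W : Set (Fin n))ᶜ) a b)) :=
      Finset.sum_nonneg fun W _ => mul_nonneg measureReal_nonneg (Finset.le_inf' _ _ fun a _ => measureReal_nonneg)
    -- it suffices to bound the bracket of the certificate by `reach + pockets − designated`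
    suffices hbr : (if Disjoint N A then (prodBernoulli qN).real (openConn d b) - (prodBernoulli qN).real (openConn a₀ b)
        else (prodBernoulli qN).real (⋃ v ∈ N, openConn v b) - (prodBernoulli qN).real (openConn a₀ b))
        ≤ (prodBernoulli qN).real (⋃ v ∈ N, openConn v b)
          + (∑ W ∈ (Finset.univ : Finset (Finset (Fin n))).filter (fun W => Disjoint W A),
              (prodBernoulli qN).real {ω : BondConfig (Fin n) | ∀ z : Fin n, (z ∈ W ↔ ω ∈ ⋃ v ∈ N, openConn v z)}
                * A.inf' ⟨b, hb⟩ (fun a => (prodBernoulli qN).real (openConnIn ((W : Set (Fin n))ᶜ) a b)))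
          - (prodBernoulli qN).real (openConn a₀ b) ∨ m = 0 by
      rcases hbr with hbr | hm00
      · have := mul_le_mul_of_nonneg_left hbr hm0
        nlinarith [this]
      · rw [hm00]
        simp only [zero_mul, add_zero, sub_zero, le_refl]
    by_cases hmz : m = 0
    · exact Or.inr hmz
    refine Or.inl ?_
    split_ifs with hNA
    · -- relay-free layer: `τ_q(d ↔ b) ≤ reach + pockets`
      suffices hgoal : (prodBernoulli qN).real (openConn d b)
          ≤ (prodBernoulli qN).real (⋃ v ∈ N, openConn v b)
            + ∑ W ∈ (Finset.univ : Finset (Finset (Fin n))).filter (fun W => Disjoint W A),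
                (prodBernoulli qN).real {ω : BondConfig (Fin n) | ∀ z : Fin n, (z ∈ W ↔ ω ∈ ⋃ v ∈ N, openConn v z)}
                  * A.inf' ⟨b, hb⟩ (fun a => (prodBernoulli qN).real (openConnIn ((W : Set (Fin n))ᶜ) a b)) by
        linarith
      by_cases hN0 : N = ∅
      · -- the empty layer: `pockets(∅) = min_A τ` and `d` is a minimiser
        subst hN0
        have hq : qN = (fun e : Sym2 (Fin n) => if (∃ y ∈ e, y ∈ S) then (0 : unitInterval) else u e) := by
          rw [hqN]; exact wbk_q_empty u S
        rw [hq]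
        have hreach : (⋃ v ∈ (∅ : Finset (Fin n)), (openConn v b : Set (BondConfig (Fin n)))) = ∅ := by simp
        rw [hreach, measureReal_empty, zero_add]
        have hev1 : {ω : BondConfig (Fin n) | ∀ z : Fin n, (z ∈ (∅ : Finset (Fin n)) ↔ ω ∈ ⋃ v ∈ (∅ : Finset (Fin n)), openConn v z)}
            = Set.univ := by
          ext ω; simp
        have h0A : (∅ : Finset (Fin n)) ∈ (Finset.univ : Finset (Finset (Fin n))).filter (fun W => Disjoint W A) := by
          simp
        refine le_trans ?_ (Finset.single_le_sum (fun W _ => mul_nonneg measureReal_nonneg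
          (Finset.le_inf' _ _ fun a _ => measureReal_nonneg)) h0A)
        rw [hev1, probReal_univ, one_mul]
        refine Finset.le_inf' _ _ fun a ha => ?_
        have huniv : (openConnIn (((∅ : Finset (Fin n)) : Set (Fin n))ᶜ) a b : Set (BondConfig (Fin n))) = openConn a b := by
          ext ω
          rw [Finset.coe_empty, Set.compl_empty]
          exact (BlockExploration.mem_openConn_iff_openConnIn_univ).symm
        rw [huniv]
        exact hdmin a ha
      · -- a non-empty relay-free layer of positive mass: `HBLK` in the star-killed weighting, then glue `N`
        have hpos := sigmaRec_posLayer u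
          (fun e : Sym2 (Fin n) => if (∀ y ∈ e, y ∈ S) ∧ ¬ e.IsDiag then 1 else u e) S N (fun o x hx => by
          have hnot : ¬ ((∀ y ∈ s(o, x), y ∈ S) ∧ ¬ (s(o, x)).IsDiag) := fun h => hx (h.1 x (Sym2.mem_mk_right o x))
          simp only [hnot, if_false]) hmz
        obtain ⟨y, hyN⟩ := Finset.nonempty_iff_ne_empty.2 hN0
        obtain ⟨-, o, hoS, hoy⟩ := hpos y hyN
        have hoy' : (u s(o, y) : ℝ) ≠ 0 := fun h => hoy (Subtype.ext (by exact_mod_cast h))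
        have hlt := bk_card_lt u S hoS hoy'
        have hgood := hblk (fun e : Sym2 (Fin n) => if (∃ y ∈ e, y ∈ S) then (0 : unitInterval) else u e)
          hlt A N b d hb hNA hdA hdmin
        -- glue `N` on top of the star-killed weighting
        have hglue1 := blockGrowth_glue_real_openConn
          (fun e : Sym2 (Fin n) => if (∃ y ∈ e, y ∈ S) then (0 : unitInterval) else u e) N d b
        have hglue2 := blockGrowth_glue_real_iUnion
          (fun e : Sym2 (Fin n) => if (∃ y ∈ e, y ∈ S) then (0 : unitInterval) else u e) N b
        have hglue3 := bk_pockets_glue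
          (fun e : Sym2 (Fin n) => if (∃ y ∈ e, y ∈ S) then (0 : unitInterval) else u e) A N b hb
        rw [hqN, hglue1, hglue2, hglue3]
        exact hgood
    · -- relay layer: only the pockets are lost
      linarith
  have hle := Finset.sum_le_sum fun N (_ : N ∈ (Finset.univ : Finset (Finset (Fin n)))) => hterm N
  rw [Finset.sum_sub_distrib, Finset.sum_add_distrib] at hle
  linarith

/-- Registered stub `stub_wholeBlockKernel_c5` of crux stmt-CriticalPhenomena-4576 (lead c5, line `peel`, skeleton v7): **the whole-block
kernel** — the corner identity over the open outer boundary of the block plus the leaf bounds turn a non-negative whole-block certificate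
into block goodness at `a₀` (worst selection).  Composition of `wholeBlockKernel_of` with the landed identities
`stub_wholeBlockReach_c5`, `stub_wholeBlockDesignated_c5`, `stub_wholeBlockPockets_c5` and `stub_isolatedBlock_c5`.
[cite: KozmaNitzan2024, §3.2 Thms 4–5 pp. 12–14] -/
theorem stub_wholeBlockKernel_c5 :
    ∀ (n : ℕ) (u : Sym2 (Fin n) → unitInterval) (A S : Finset (Fin n)) (b a₀ d : Fin n) (hb : b ∈ A),
      Disjoint S A → a₀ ∈ A → d ∈ A →
      (∀ a ∈ A, (prodBernoulli u).real (openConn a₀ b) ≤ (prodBernoulli u).real (openConn a b)) →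
      (∀ a ∈ A, (prodBernoulli (fun e : Sym2 (Fin n) => if (∃ y ∈ e, y ∈ S) then (0 : unitInterval) else u e)).real (openConn d b) ≤ (prodBernoulli (fun e : Sym2 (Fin n) => if (∃ y ∈ e, y ∈ S) then (0 : unitInterval) else u e)).real (openConn a b)) →
      (∀ w' : Sym2 (Fin n) → unitInterval,
        (Finset.univ.filter (fun v : Fin n => ∃ y : Fin n, 0 < (w' s(y, v) : ℝ))).card
          < (Finset.univ.filter (fun v : Fin n => ∃ y : Fin n, 0 < (u s(y, v) : ℝ))).card →
        ∀ (A' S' : Finset (Fin n)) (b' d' : Fin n) (hb' : b' ∈ A'), Disjoint S' A' → d' ∈ A' →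
        (∀ a ∈ A', (prodBernoulli w').real (openConn d' b') ≤ (prodBernoulli w').real (openConn a b')) →
        (prodBernoulli w').real (openConn d' b')
          + (prodBernoulli w').real
              ((openConn d' b')ᶜ ∩ (⋃ v ∈ S', openConn d' v) ∩ (⋃ v ∈ S', openConn v b'))
        ≤ (prodBernoulli w').real (⋃ v ∈ S', openConn v b')
          + (∑ W ∈ (Finset.univ : Finset (Finset (Fin n))).filter (fun W => Disjoint W A'),
              (prodBernoulli w').real
                  {ω : BondConfig (Fin n) | ∀ z : Fin n, (z ∈ W ↔ ω ∈ ⋃ v ∈ S', openConn v z)}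
                * A'.inf' ⟨b', hb'⟩ (fun a => (prodBernoulli w').real (openConnIn ((W : Set (Fin n))ᶜ) a b')))) →
      0 ≤ ∑ N : Finset (Fin n), (prodBernoulli (fun e : Sym2 (Fin n) => if (∀ y ∈ e, y ∈ S) ∧ ¬ e.IsDiag then 1 else u e)).real {ω : BondConfig (Fin n) | ∀ y : Fin n, y ∈ N ↔ (y ∉ S ∧ ∃ o ∈ S, s(o, y) ∈ ω)}
          * (if Disjoint N A then
              (prodBernoulli (fun e : Sym2 (Fin n) => if (∀ y ∈ e, y ∈ N) ∧ ¬ e.IsDiag then 1 else if (∃ y ∈ e, y ∈ S) then 0 else u e)).real (openConn d b) - (prodBernoulli (fun e : Sym2 (Fin n) => if (∀ y ∈ e, y ∈ N) ∧ ¬ e.IsDiag then 1 else if (∃ y ∈ e, y ∈ S) then 0 else u e)).real (openConn a₀ b)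
            else
              (prodBernoulli (fun e : Sym2 (Fin n) => if (∀ y ∈ e, y ∈ N) ∧ ¬ e.IsDiag then 1 else if (∃ y ∈ e, y ∈ S) then 0 else u e)).real (⋃ v ∈ N, openConn v b) - (prodBernoulli (fun e : Sym2 (Fin n) => if (∀ y ∈ e, y ∈ N) ∧ ¬ e.IsDiag then 1 else if (∃ y ∈ e, y ∈ S) then 0 else u e)).real (openConn a₀ b)) →
      (prodBernoulli u).real (openConn a₀ b)
          + (prodBernoulli u).real
              ((openConn a₀ b)ᶜ ∩ (⋃ v ∈ S, openConn a₀ v) ∩ (⋃ v ∈ S, openConn v b))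
        ≤ (prodBernoulli u).real (⋃ v ∈ S, openConn v b)
          + (∑ W ∈ (Finset.univ : Finset (Finset (Fin n))).filter (fun W => Disjoint W A),
              (prodBernoulli u).real
                  {ω : BondConfig (Fin n) | ∀ z : Fin n, (z ∈ W ↔ ω ∈ ⋃ v ∈ S, openConn v z)}
                * A.inf' ⟨b, hb⟩ (fun a => (prodBernoulli u).real (openConnIn ((W : Set (Fin n))ᶜ) a b))) :=
  wholeBlockKernel_of stub_wholeBlockReach_c5 stub_wholeBlockDesignated_c5 stub_wholeBlockPockets_c5 stub_isolatedBlock_c5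

end WholeBlockKernel

end

end Summit.CriticalPhenomena.PercolationContinuityZ3.Theorems
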